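import Summits.RiemannHypothesis.RiemannHypothesis.Theorems.GroundBartaEvenWinsBeyondArchDeflationPanelGlue
import Literature.NumberTheory.LFunctions.WeilArchDensityTail
import HarnessLib

/-!
# RiemannHypothesis / GroundBarta — rung 4 (`EvenWinsBeyondArch`, stmt-RiemannHypothesis-18807 / 18085):
# the deflated Temple L-side, XVIII c — the window glue: residual norm `s_i` from per-panel bounds of the explicit real residual

Helper file (`--supports stmt-RiemannHypothesis-18807`), RH-free, Mathlib + landed tree files only, no definitions, no facts.
Prover B, speedrun unit `sr-gb-rung-b` (gen 4).

The last structural step of the R-layer: for the `i`-th polynomial trial vector, the hypothesis `hs : ∫‖F_i − Σ_l W_il v_l‖² ≤ s_i` of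
the sigma criterion (file XIII) follows from per-panel bounds `∫_{-h}^{h} R_i(y_k+ρ)² dρ ≤ q_k`, `k < m`, of ONE explicit real function

  `R_i(y) = 2P_c cosh(y/2) − 2P_s sinh(y/2) + Σ_{j≤3} w_j (2g_i(y) − ĝ_i(y−L_j) − ĝ_i(y+L_j)) + [arch split] + g_i(y)(Ψ(c−y)+Ψ(c+y))
            − M̃ g_i(y) − Σ_l W̃_il g_l(y)`

(three prime slots `(w_j, L_j)` realising `Σ_{n∈weilPrimeIndex c}` — hypothesis `hprimes`, discharged per window by
`sum_weilPrimeIndex_eq_twoPrime/threePrime`; `M̃`, `W̃` arbitrary reals, the true `W` being `W̃ + [l=i](M̃ − M_c)`, file XVII d):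
`dt_residual_normSq_le_of_panelBounds` gives `∫‖F_i − Σ_l W_il v_l‖² ≤ 2 Σ_{k<m} q_k`, and `dt_windowResidual_sq_intervalIntegrable` the
integrability side condition of the per-panel rules (files XVIII a/b, `TaylorModelL2`, `TaylorModelL2Split`).  What remains per window is
numerical: the `q_k` (XVIII a/b) and the A-layer matrix check.

References: E. Bombieri, Rend. Mat. Acc. Lincei (9) 11 (2000) Thm 2 [Bombieri2000Weil]; Goerisch–Haunhorst (1985) [GoerischHaunhorst1985].
-/

set_option linter.dupNamespace false

noncomputable section

open MeasureTheory Set Filter Finset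
open scoped Topology BigOperators

namespace Summit.RiemannHypothesis.RiemannHypothesis.Theorems.EvenWinsBeyondArch

open Literature.NumberTheory.LFunctions
open Literature.Analysis.ValidatedNumerics.ExpPoly

/-- `Poly.eval p` is smooth. -/
theorem dt_contDiff_polyEval {n : WithTop ℕ∞} : ∀ p : Poly, ContDiff ℝ n (fun x : ℝ ↦ Poly.eval p x)
  | [] => by simpa [Poly.eval] using contDiff_const
  | c :: p => by
      have ih := dt_contDiff_polyEval (n := n) p
      simpa [Poly.eval] using contDiff_const.add (contDiff_id.mul ih)

section Window

variable {c : ℝ} {k : ℕ} {gp : Fin k → Poly} {v F : Fin k → ℝ → ℂ}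

/-- The explicit real residual of the `i`-th vector with three prime slots and the rational stand-ins `M̃`, `W̃` (a function of `y`). -/
def dt_windowResidual (c : ℝ) (gp : Fin k → Poly) (w1 L1 w2 L2 w3 L3 Mt : ℝ) (Wt : Fin k → Fin k → ℝ) (i : Fin k)
    (y : ℝ) : ℝ :=
  (2 * (∫ x in (-c)..c, Poly.eval (gp i) x * Real.cosh (x / 2)) * Real.cosh (y / 2) -
      2 * (∫ x in (-c)..c, Poly.eval (gp i) x * Real.sinh (x / 2)) * Real.sinh (y / 2)) +
    (w1 * (2 * Poly.eval (gp i) y - (Icc (-c) c).indicator (fun x ↦ Poly.eval (gp i) x) (y - L1) -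
        (Icc (-c) c).indicator (fun x ↦ Poly.eval (gp i) x) (y + L1)) +
      w2 * (2 * Poly.eval (gp i) y - (Icc (-c) c).indicator (fun x ↦ Poly.eval (gp i) x) (y - L2) -
        (Icc (-c) c).indicator (fun x ↦ Poly.eval (gp i) x) (y + L2)) +
      w3 * (2 * Poly.eval (gp i) y - (Icc (-c) c).indicator (fun x ↦ Poly.eval (gp i) x) (y - L3) -
        (Icc (-c) c).indicator (fun x ↦ Poly.eval (gp i) x) (y + L3))) +
    ((∫ t in Ioc 0 (c - y), weilArchDensityG t *
        ((2 * Poly.eval (gp i) y - Poly.eval (gp i) (y - t) - Poly.eval (gp i) (y + t)) / t)) +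
      ∫ t in Ioc (c - y) (c + y), weilArchDensityG t * ((Poly.eval (gp i) y - Poly.eval (gp i) (y - t)) / t)) +
    Poly.eval (gp i) y * (weilArchTail (c - y) + weilArchTail (c + y)) -
    Mt * Poly.eval (gp i) y - ∑ l, Wt i l * Poly.eval (gp l) y

/-- **The residual of file XV is the explicit real residual** (on `[0, c)`), for `W = W̃ + [l=i](M̃ − M_c)`, given the three-slot
form of the prime sum. [cite: Bombieri2000Weil, Thm 2] -/
theorem dt_residual_eq_windowResidual (hc : 0 < c)
    (hv : ∀ i x, v i x = (((Icc (-c) c).indicator (fun x ↦ Poly.eval (gp i) x) x : ℝ) : ℂ))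
    (hF : ∀ i y, F i y = (Icc (-c) c).indicator (fun y ↦
        2 * (∫ x, v i x * (Real.cosh (x / 2) : ℂ)) * (Real.cosh (y / 2) : ℂ) -
          2 * (∫ x, v i x * (Real.sinh (x / 2) : ℂ)) * (Real.sinh (y / 2) : ℂ) +
        (∑ n ∈ weilPrimeIndex c, (((ArithmeticFunction.vonMangoldt n : ℝ) / Real.sqrt n : ℝ) : ℂ) *
          (2 * v i y - v i (y - Real.log n) - v i (y + Real.log n))) +
        ∫ t in Ioi 0, (weilArchDensity t : ℂ) * (2 * v i y - v i (y - t) - v i (y + t))) y -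
      (weilMarkovConstant c : ℂ) * v i y)
    {w1 L1 w2 L2 w3 L3 : ℝ} (Mt : ℝ) (Wt : Fin k → Fin k → ℝ) (i : Fin k)
    (hprimes : ∀ y : ℝ, ∑ n ∈ weilPrimeIndex c, ((ArithmeticFunction.vonMangoldt n : ℝ) / Real.sqrt n) *
        (2 * Poly.eval (gp i) y - (Icc (-c) c).indicator (fun x ↦ Poly.eval (gp i) x) (y - Real.log n) -
          (Icc (-c) c).indicator (fun x ↦ Poly.eval (gp i) x) (y + Real.log n)) =
      w1 * (2 * Poly.eval (gp i) y - (Icc (-c) c).indicator (fun x ↦ Poly.eval (gp i) x) (y - L1) -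
          (Icc (-c) c).indicator (fun x ↦ Poly.eval (gp i) x) (y + L1)) +
        w2 * (2 * Poly.eval (gp i) y - (Icc (-c) c).indicator (fun x ↦ Poly.eval (gp i) x) (y - L2) -
          (Icc (-c) c).indicator (fun x ↦ Poly.eval (gp i) x) (y + L2)) +
        w3 * (2 * Poly.eval (gp i) y - (Icc (-c) c).indicator (fun x ↦ Poly.eval (gp i) x) (y - L3) -
          (Icc (-c) c).indicator (fun x ↦ Poly.eval (gp i) x) (y + L3)))
    {y : ℝ} (hy : y ∈ Ico 0 c) :
    (F i - ∑ l, (Wt i l + if l = i then Mt - weilMarkovConstant c else 0) • v l) y =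
      (dt_windowResidual c gp w1 L1 w2 L2 w3 L3 Mt Wt i y : ℂ) := by
  rw [dt_residual_real_shift hc (g := fun l x ↦ Poly.eval (gp l) x) (fun l ↦ dt_contDiff_polyEval (gp l)) hv hF Wt Mt i hy,
    dt_windowResidual, ← hprimes y]
  simp only [weilArchTail]
  congr 1
  ring

/-- **Integrability side condition**: on every panel, `ρ ↦ R_i(y_k + ρ)²` is interval integrable. -/
theorem dt_windowResidual_sq_intervalIntegrable (hc : 0 < c)
    (hv : ∀ i x, v i x = (((Icc (-c) c).indicator (fun x ↦ Poly.eval (gp i) x) x : ℝ) : ℂ))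
    (hF : ∀ i y, F i y = (Icc (-c) c).indicator (fun y ↦
        2 * (∫ x, v i x * (Real.cosh (x / 2) : ℂ)) * (Real.cosh (y / 2) : ℂ) -
          2 * (∫ x, v i x * (Real.sinh (x / 2) : ℂ)) * (Real.sinh (y / 2) : ℂ) +
        (∑ n ∈ weilPrimeIndex c, (((ArithmeticFunction.vonMangoldt n : ℝ) / Real.sqrt n : ℝ) : ℂ) *
          (2 * v i y - v i (y - Real.log n) - v i (y + Real.log n))) +
        ∫ t in Ioi 0, (weilArchDensity t : ℂ) * (2 * v i y - v i (y - t) - v i (y + t))) y -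
      (weilMarkovConstant c : ℂ) * v i y)
    {w1 L1 w2 L2 w3 L3 : ℝ} (Mt : ℝ) (Wt : Fin k → Fin k → ℝ) (i : Fin k)
    (hprimes : ∀ y : ℝ, ∑ n ∈ weilPrimeIndex c, ((ArithmeticFunction.vonMangoldt n : ℝ) / Real.sqrt n) *
        (2 * Poly.eval (gp i) y - (Icc (-c) c).indicator (fun x ↦ Poly.eval (gp i) x) (y - Real.log n) -
          (Icc (-c) c).indicator (fun x ↦ Poly.eval (gp i) x) (y + Real.log n)) =
      w1 * (2 * Poly.eval (gp i) y - (Icc (-c) c).indicator (fun x ↦ Poly.eval (gp i) x) (y - L1) -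
          (Icc (-c) c).indicator (fun x ↦ Poly.eval (gp i) x) (y + L1)) +
        w2 * (2 * Poly.eval (gp i) y - (Icc (-c) c).indicator (fun x ↦ Poly.eval (gp i) x) (y - L2) -
          (Icc (-c) c).indicator (fun x ↦ Poly.eval (gp i) x) (y + L2)) +
        w3 * (2 * Poly.eval (gp i) y - (Icc (-c) c).indicator (fun x ↦ Poly.eval (gp i) x) (y - L3) -
          (Icc (-c) c).indicator (fun x ↦ Poly.eval (gp i) x) (y + L3)))
    {m : ℕ} (hm : 0 < m) {j : ℕ} (hjm : j < m) :
    IntervalIntegrable (fun ρ ↦ dt_windowResidual c gp w1 L1 w2 L2 w3 L3 Mt Wt i ((2 * j + 1) * (c / (2 * m)) + ρ) ^ 2) volume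
      (-(c / (2 * m))) (c / (2 * m)) :=
  dt_residual_sq_intervalIntegrable hc (fun l x ↦ Poly.eval (gp l) x) (fun l ↦ dt_contDiff_polyEval (gp l)) v F hv hF
    (fun i l ↦ Wt i l + if l = i then Mt - weilMarkovConstant c else 0) i hm _
    (fun _ hy ↦ dt_residual_eq_windowResidual hc hv hF Mt Wt i hprimes hy) hjm

/-- **The window glue**: per-panel bounds of the explicit real residual give the residual norm bound `hs` of the sigma criterion,
with the true coefficient matrix `W = W̃ + [l=i](M̃ − M_c)` (which never has to be evaluated).
[cite: GoerischHaunhorst1985, §2] [cite: Bombieri2000Weil, Thm 2] -/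
theorem dt_residual_normSq_le_of_panelBounds (hc : 0 < c) {σ : ℝ} (hσ : σ = 1 ∨ σ = -1)
    (hgp : ∀ i x, Poly.eval (gp i) (-x) = σ * Poly.eval (gp i) x)
    (hv : ∀ i x, v i x = (((Icc (-c) c).indicator (fun x ↦ Poly.eval (gp i) x) x : ℝ) : ℂ))
    (hF : ∀ i y, F i y = (Icc (-c) c).indicator (fun y ↦
        2 * (∫ x, v i x * (Real.cosh (x / 2) : ℂ)) * (Real.cosh (y / 2) : ℂ) -
          2 * (∫ x, v i x * (Real.sinh (x / 2) : ℂ)) * (Real.sinh (y / 2) : ℂ) +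
        (∑ n ∈ weilPrimeIndex c, (((ArithmeticFunction.vonMangoldt n : ℝ) / Real.sqrt n : ℝ) : ℂ) *
          (2 * v i y - v i (y - Real.log n) - v i (y + Real.log n))) +
        ∫ t in Ioi 0, (weilArchDensity t : ℂ) * (2 * v i y - v i (y - t) - v i (y + t))) y -
      (weilMarkovConstant c : ℂ) * v i y)
    {w1 L1 w2 L2 w3 L3 : ℝ} (Mt : ℝ) (Wt : Fin k → Fin k → ℝ) (i : Fin k)
    (hprimes : ∀ y : ℝ, ∑ n ∈ weilPrimeIndex c, ((ArithmeticFunction.vonMangoldt n : ℝ) / Real.sqrt n) *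
        (2 * Poly.eval (gp i) y - (Icc (-c) c).indicator (fun x ↦ Poly.eval (gp i) x) (y - Real.log n) -
          (Icc (-c) c).indicator (fun x ↦ Poly.eval (gp i) x) (y + Real.log n)) =
      w1 * (2 * Poly.eval (gp i) y - (Icc (-c) c).indicator (fun x ↦ Poly.eval (gp i) x) (y - L1) -
          (Icc (-c) c).indicator (fun x ↦ Poly.eval (gp i) x) (y + L1)) +
        w2 * (2 * Poly.eval (gp i) y - (Icc (-c) c).indicator (fun x ↦ Poly.eval (gp i) x) (y - L2) -
          (Icc (-c) c).indicator (fun x ↦ Poly.eval (gp i) x) (y + L2)) +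
        w3 * (2 * Poly.eval (gp i) y - (Icc (-c) c).indicator (fun x ↦ Poly.eval (gp i) x) (y - L3) -
          (Icc (-c) c).indicator (fun x ↦ Poly.eval (gp i) x) (y + L3)))
    {m : ℕ} (hm : 0 < m) (q : ℕ → ℝ)
    (hq : ∀ j, j < m → ∫ ρ in (-(c / (2 * m)))..(c / (2 * m)),
      dt_windowResidual c gp w1 L1 w2 L2 w3 L3 Mt Wt i ((2 * j + 1) * (c / (2 * m)) + ρ) ^ 2 ≤ q j) :
    ∫ y, ‖(F i - ∑ l, (Wt i l + if l = i then Mt - weilMarkovConstant c else 0) • v l) y‖ ^ 2 ≤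
      2 * ∑ j ∈ Finset.range m, q j :=
  dt_residual_normSq_le_of_panels hc hσ (fun l x ↦ Poly.eval (gp l) x) (fun l ↦ dt_contDiff_polyEval (gp l)) hgp v F hv hF
    (fun i l ↦ Wt i l + if l = i then Mt - weilMarkovConstant c else 0) i hm _
    (fun _ hy ↦ dt_residual_eq_windowResidual hc hv hF Mt Wt i hprimes hy) q hq

end Window

end Summit.RiemannHypothesis.RiemannHypothesis.Theorems.EvenWinsBeyondArch

end
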